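import Literature.MathematicalPhysics.QuantumFieldTheory.Balaban1983to89.Beta.PlaquetteVertex

/-!
# Ward identities for the Wilson plaquette jets: the gauge degeneracy of the fluctuation Hessian at order `B¹`, with a commutator-sum certificate

HONEST FRAMING (cell `pub-balaban`, β sub-cell, lineage an3; verbatim): discharging `BetaPertH` makes Bałaban's UV stability
UNCONDITIONAL — a real constructive-QFT result; it is NOT the continuum limit and NOT the Clay problem.  This file discharges NOTHING
of `BetaPertH`.  ABSOLUTE RULE of the cell (verbatim): «No internally-minted statement may enter as a cited fact. Every hypothesis is
either kernel-proved in this package or a verbatim quotation of a PUBLISHED theorem with page reference. The manuscript(s) under audit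
are NOT citable for their own disputed steps — they are the thing under adjudication; programme-internal (2001/route/tribunal) claims
are never citable.»  Accordingly every declaration below is a definition or is kernel-proved here from the imports; NOTHING is cited;
no `def … : Prop` occurs at all.

## What is proved

Write `F_{n,m}` for the part of `τ(U(∂p))` of degree `n` in the fluctuation letters `W` and `m` in the background letters `B` in the
cell's chart `U_b = e^{W_b}·e^{B_b}` (fluctuation LEFT, `Beta.WilsonVertex.plaq`; [Balaban1985BackgroundPropagators] (3.1) p. 390):
`F_{2,1} = τ ∘ P21`, `F_{2,0} = τ ∘ quad ∘ wpart`, `F_{1,1} = τ ∘ P11`, `F_{1,0} = τ ∘ sum ∘ wpart` (`Beta.WilsonVertex`,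
`Beta.TransportVertices`).  Label the corners of the plaquette `x₁ → x₂ → x₃ ← x₄ ← x₁` as the word does (`b₁ : x₁ → x₂`,
`b₂ : x₂ → x₃`, `b₃ : x₄ → x₃`, `b₄ : x₁ → x₄`) and let `λ₁, …, λ₄` be Lie-algebra letters at the corners.  The GAUGE DIRECTIONS of the
chart at order `B⁰` and `B¹` are the bond fields
`W₀λ := (λ₁ − λ₂, λ₂ − λ₃, λ₄ − λ₃, λ₁ − λ₄)` (`λ(b₋) − λ(b₊)`) and `W₁(B)λ := (−[B₁,λ₂], −[B₂,λ₃], −[B₃,λ₃], −[B₄,λ₄])`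
(`−[B_b, λ(b₊)]`), and the CURRENT ARGUMENT is `N₀(h)λ := ([h₁, λ₁+λ₂], [h₂, λ₂+λ₃], [h₃, λ₄+λ₃], [h₄, λ₁+λ₄])` (`[h_b, λ(b₋)+λ(b₊)]`).
With the polarisation `Pol f (h, v) := f(h + v) − f(h) − f(v)` (for a quadratic `f`, twice its symmetric bilinear form) the theorems
are, for EVERY ring `𝔸`, every `𝕜`-linear TRACIAL `τ` and ALL letters:

* `ward21` (ORDER `B¹`, per plaquette):
  `2·Pol F_{2,1}(h, W₀λ) + 2·Pol F_{2,0}(h, W₁(B)λ) = F_{1,1}(N₀(h)λ)`;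
* `ward20` (ORDER `B⁰`): `Pol F_{2,0}(h, W₀λ) = 0` (and `F_{1,0}(N₀(h)λ) = 0`: at `B = 0` both sides vanish separately);
* `ward11`, `ward10` (FIRST ORDER): `F_{1,1}(W₀λ) = 0`, `F_{1,0}(W₁(B)λ) = 0` — the current annihilates gauge directions, no
  correction term;
* `ward21_const` (CONSTANT BACKGROUND, `B₁ = B₃ = X`, `B₂ = B₄ = Y`): the right-hand side of `ward21` vanishes PER PLAQUETTE
  (`trace_P11_plaq_const`), so there `2·Pol F_{2,1}(h, W₀λ) + 2·Pol F_{2,0}(h, W₁(B)λ) = 0` with no current term;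
* `jet21_ward` (LATTICE-SUMMED form of `ward21` for `Beta.PlaquetteVertex.jet21` / `jet20` and the summed `(1,1)`-jet `jet11`
  defined here, with the gauge-direction FIELDS `gaugeDir₀`, `gaugeDir₁` and the current-argument field `currArg₀`).

Each identity is proved from the tree's closed forms BY NAME (`WilsonVertex.two_smul_trace_P21`, `twist_plaq`, `P11_eq`,
`TransportVertices.two_smul_quad`, `commSum_four`) plus an explicit COMMUTATOR-SUM CERTIFICATE: the difference of the two sides,
as an element of `𝔸`, EQUALS a listed sum of commutators `[X_k, Y_k]` (checked by `noncomm_ring` in the free ring), and a tracial `τ`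
kills every commutator (`trace_csum`).  No Baker–Campbell–Hausdorff series, no analysis, no cited fact.

## Why (the dictionary to `Beta.LagrangianGaugeDegeneracy`, hypothesis (I1))

`Beta.LagrangianGaugeDegeneracy.actionHessian_mulVec_gaugeDir` takes the hypothesis (I1) `S₂ *ᵥ w_a + (N a)ᵀ *ᵥ s₁ = 0`: the Hessian
of the action applied to a gauge direction equals minus the transposed infinitesimal-gauge matrix applied to the gradient (the
current).  `ward21` IS that identity for the Wilson plaquette jets at order `B¹`, entry by entry: `S₂ ↔ 2·Pol F_{2,•}`,
`w ↔ W₀λ + W₁(B)λ`, `s₁ ↔ F_{1,•}`, `N_λ h ↔ −½·N₀(h)λ = −½[h_b, λ(b₋)+λ(b₊)]` (at order `B⁰`; the sign and the `½` are absorbed in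
the statement, which carries the factor `2` on the Hessian side and `+1` on the current side).  PROVENANCE of the shape (NOT used in
any proof): `τ(U(∂p))` is invariant under `U_b ↦ u(x_{b₋})·U_b·u(x_{b₊})⁻¹`, `u = e^{λ}`; in the chart with `B` fixed the
induced motion of `W` is `δW_b = (λ(b₋) − Ad_{e^{B_b}}λ(b₊)) − ½[W_b, λ(b₋) + Ad_{e^{B_b}}λ(b₊)] + O(W²)`, whose graded pieces are
`W₀λ`, `W₁(B)λ` and `−½N₀(h)λ` above; differentiating the invariance once in `W` at bilinear level gives `ward21`/`ward20`.  The
identities were first found and checked by two independent engines archived in the cell (`records/ward/ward_free.py` sha256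
`873232d3211d18f3…`: exact free-algebra expansion, 64 = 64 cyclic words at `(h¹, λ¹, B¹)`; `records/ward/ward_check.py` sha256
`f66853643ec43d5b…`: SU(2) numerics to `2.7e-7`); the kernel proofs below supersede both.

## What this file does NOT do

It does not state (I1) beyond order `B¹` (order `B²` needs `Beta.WilsonVertex2.P22`; the naive order-`B¹` identity WITHOUT the
current term is FALSE off constant backgrounds — engine A measured the defect, coefficient `−3.86` at `L = 3` — and is nowhere
stated); it says nothing about the minimiser manifold, the hypotheses (K2), (L) of `Beta.LagrangianGaugeDegeneracy`, the
hypotheses (c1)–(c3) of `Beta.GaugeFixing`, or any estimate; it moves no wall statement; it is not summit progress, not the continuum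
limit, not Clay.  [folklore] throughout: trilinear algebra in an arbitrary normed algebra.
-/

namespace Literature.MathematicalPhysics.QuantumFieldTheory.Balaban1983to89.Beta.WilsonWardJets

open Finset
open scoped BigOperators
open Literature.MathematicalPhysics.QuantumFieldTheory.Balaban1983to89.Beta.TransportVertices
open Literature.MathematicalPhysics.QuantumFieldTheory.Balaban1983to89.Beta.WilsonVertex
open Literature.MathematicalPhysics.QuantumFieldTheory.Balaban1983to89.Beta.PlaquetteVertex (plaqWord jet21 jet20)

/-! ## §1 Commutator-sum certificates: a tracial functional kills a listed sum of commutators -/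

section Certificates

variable (𝕜 : Type*) [RCLike 𝕜] {𝔸 : Type*} [NormedRing 𝔸] [NormedAlgebra 𝕜 𝔸]
variable {V : Type*} [AddCommGroup V] [Module 𝕜 V]

/-- The commutator sum of a list of pairs: `csum [(X₁,Y₁), …, (X_n,Y_n)] = Σ_k (X_k·Y_k − Y_k·X_k)`.  The CERTIFICATE format of this
file: an identity `a = b` modulo the trace is certified by exhibiting `K` with `a − b = csum K`.  A definition asserting nothing.
[folklore] -/
def csum : List (𝔸 × 𝔸) → 𝔸
  | [] => 0
  | p :: K => (p.1 * p.2 - p.2 * p.1) + csum K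

omit [NormedAlgebra 𝕜 𝔸] in
/-- `csum [] = 0`. [folklore] -/
@[simp] theorem csum_nil : csum ([] : List (𝔸 × 𝔸)) = 0 := rfl

omit [NormedAlgebra 𝕜 𝔸] in
/-- `csum ((X, Y) :: K) = (X·Y − Y·X) + csum K`. [folklore] -/
@[simp] theorem csum_cons (p : 𝔸 × 𝔸) (K : List (𝔸 × 𝔸)) : csum (p :: K) = (p.1 * p.2 - p.2 * p.1) + csum K := rfl

/-- A TRACIAL linear functional vanishes on every commutator sum. [folklore] -/
theorem trace_csum (τ : 𝔸 →ₗ[𝕜] V) (hτ : ∀ a b : 𝔸, τ (a * b) = τ (b * a)) (K : List (𝔸 × 𝔸)) : τ (csum K) = 0 := by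
  induction K with
  | nil => rw [csum_nil, map_zero]
  | cons p K ih => rw [csum_cons, map_add, map_sub, hτ p.1 p.2, sub_self, zero_add, ih]

/-- CERTIFICATE RULE: if `a − b` is a commutator sum then `τ a = τ b` for every tracial `τ`. [folklore] -/
theorem trace_eq_of_sub_eq_csum (τ : 𝔸 →ₗ[𝕜] V) (hτ : ∀ a b : 𝔸, τ (a * b) = τ (b * a)) (K : List (𝔸 × 𝔸)) {a b : 𝔸}
    (h : a - b = csum K) : τ a = τ b := by
  rw [← sub_eq_zero, ← map_sub, h, trace_csum 𝕜 τ hτ]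

/-- CERTIFICATE RULE (vanishing form): if `a` is a commutator sum then `τ a = 0` for every tracial `τ`. [folklore] -/
theorem trace_eq_zero_of_eq_csum (τ : 𝔸 →ₗ[𝕜] V) (hτ : ∀ a b : 𝔸, τ (a * b) = τ (b * a)) (K : List (𝔸 × 𝔸)) {a : 𝔸}
    (h : a = csum K) : τ a = 0 := by
  rw [h, trace_csum 𝕜 τ hτ]

/-- `2·τ(quad l) = τ((Σl)² + commSum l)` — `TransportVertices.two_smul_quad` pushed through a linear `τ`. [folklore] -/
theorem two_smul_trace_quad (τ : 𝔸 →ₗ[𝕜] V) (l : List 𝔸) :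
    (2 : 𝕜) • τ (quad 𝕜 l) = τ (l.sum * l.sum + commSum l) := by
  rw [← map_smul, two_smul_quad]

end Certificates

/-! ## §2 First-order Ward identities: the current annihilates the gauge directions -/

section FirstOrder

variable (𝕜 : Type*) [RCLike 𝕜] {𝔸 : Type*} [NormedRing 𝔸] [NormedAlgebra 𝕜 𝔸]
variable {V : Type*} [AddCommGroup V] [Module 𝕜 V]
variable (τ : 𝔸 →ₗ[𝕜] V) (B₁ B₂ B₃ B₄ h₁ h₂ h₃ h₄ l₁ l₂ l₃ l₄ : 𝔸)

/-- **`F_{1,1}(W₀λ) = 0`**: the `(1,1)`-jet of `τ(U(∂p))` vanishes on the order-`B⁰` gauge direction `W₀λ = (λ₁−λ₂, λ₂−λ₃, λ₄−λ₃, λ₁−λ₄)`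
for every background (its curl is zero and the transport term is a sum of commutators).  Certificate: 8 commutators. [folklore] -/
theorem ward11 (hτ : ∀ a b : 𝔸, τ (a * b) = τ (b * a)) :
    τ (P11 (plaq (l₁ - l₂) (l₂ - l₃) (l₄ - l₃) (l₁ - l₄) B₁ B₂ B₃ B₄)) = 0 := by
  refine trace_eq_zero_of_eq_csum 𝕜 τ hτ
    [(B₁, l₂), (B₂, l₃), (l₃, B₃), (l₁, B₁), (l₁, B₂), (B₃, l₁), (B₄, l₁), (l₄, B₄)] ?_
  simp only [P11_eq, wpart_plaq, bpart_plaq, twist_plaq, sum_four_signed, csum_cons, csum_nil]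
  noncomm_ring

/-- **`F_{1,0}(W₁(B)λ) = 0`**: the `(1,0)`-jet (the signed letter sum) vanishes on the order-`B¹` gauge direction
`W₁(B)λ = (−[B₁,λ₂], −[B₂,λ₃], −[B₃,λ₃], −[B₄,λ₄])` (a sum of commutators).  Certificate: 4 commutators. [folklore] -/
theorem ward10 (hτ : ∀ a b : 𝔸, τ (a * b) = τ (b * a)) :
    τ ((wpart (plaq (l₂ * B₁ - B₁ * l₂) (l₃ * B₂ - B₂ * l₃) (l₃ * B₃ - B₃ * l₃) (l₄ * B₄ - B₄ * l₄) B₁ B₂ B₃ B₄)).sum) = 0 := by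
  refine trace_eq_zero_of_eq_csum 𝕜 τ hτ
    [(l₂, B₁), (l₃, B₂), (B₃, l₃), (B₄, l₄)] ?_
  simp only [wpart_plaq, sum_four_signed, csum_cons, csum_nil]
  noncomm_ring

/-- **`F_{1,0}` vanishes on every field of commutator letters**, in particular on the current argument `N₀(h)λ`
(used at order `B⁰`, where the right-hand side of the Ward identity is `F_{1,0}(N₀(h)λ) = 0`). [folklore] -/
theorem trace_wsum_plaq_comm (hτ : ∀ a b : 𝔸, τ (a * b) = τ (b * a)) (p₁ q₁ p₂ q₂ p₃ q₃ p₄ q₄ : 𝔸) :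
    τ ((wpart (plaq (p₁ * q₁ - q₁ * p₁) (p₂ * q₂ - q₂ * p₂) (p₃ * q₃ - q₃ * p₃) (p₄ * q₄ - q₄ * p₄) B₁ B₂ B₃ B₄)).sum) = 0 := by
  refine trace_eq_zero_of_eq_csum 𝕜 τ hτ [(p₁, q₁), (p₂, q₂), (q₃, p₃), (q₄, p₄)] ?_
  simp only [wpart_plaq, sum_four_signed, csum_cons, csum_nil]
  noncomm_ring

/-- **CONSTANT BACKGROUND kills the `(1,1)`-jet per plaquette**: for `B₁ = B₃ = X`, `B₂ = B₄ = Y` (a constant background field: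
`B_μ ≡ X`, `B_ν ≡ Y`) the background curl vanishes and `τ(P11(W; X, Y, X, Y)) = 0` for EVERY fluctuation field `W`.  Certificate:
2 commutators. [folklore] -/
theorem trace_P11_plaq_const (hτ : ∀ a b : 𝔸, τ (a * b) = τ (b * a)) (W₁ W₂ W₃ W₄ X Y : 𝔸) :
    τ (P11 (plaq W₁ W₂ W₃ W₄ X Y X Y)) = 0 := by
  refine trace_eq_zero_of_eq_csum 𝕜 τ hτ
    [(X, W₂), (W₃, Y)] ?_
  simp only [P11_eq, wpart_plaq, bpart_plaq, twist_plaq, sum_four_signed, csum_cons, csum_nil]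
  noncomm_ring

end FirstOrder

/-! ## §3 The second-order Ward identity at order `B⁰` and `B¹` (hypothesis (I1) for the Wilson jets) -/

section SecondOrder

variable (𝕜 : Type*) [RCLike 𝕜] {𝔸 : Type*} [NormedRing 𝔸] [NormedAlgebra 𝕜 𝔸]
variable {V : Type*} [AddCommGroup V] [Module 𝕜 V]
variable (τ : 𝔸 →ₗ[𝕜] V) (B₁ B₂ B₃ B₄ h₁ h₂ h₃ h₄ l₁ l₂ l₃ l₄ : 𝔸)

/-- **ORDER `B⁰`: `Pol F_{2,0}(h, W₀λ) = 0`** — the pure-fluctuation quadratic jet `τ(quad(W-letters))` is degenerate along the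
order-`B⁰` gauge direction, for every `h` (stated with the factor `2` of `two_smul_quad`; the right-hand side of the Ward identity
at this order is `F_{1,0}(N₀(h)λ) = 0`, `trace_wsum_plaq_comm`).  Certificate: 8 commutators. [folklore] -/
theorem ward20 (hτ : ∀ a b : 𝔸, τ (a * b) = τ (b * a)) :
    (2 : 𝕜) • τ (quad 𝕜 (wpart (plaq (h₁ + (l₁ - l₂)) (h₂ + (l₂ - l₃)) (h₃ + (l₄ - l₃)) (h₄ + (l₁ - l₄)) B₁ B₂ B₃ B₄)))
      - (2 : 𝕜) • τ (quad 𝕜 (wpart (plaq h₁ h₂ h₃ h₄ B₁ B₂ B₃ B₄)))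
      - (2 : 𝕜) • τ (quad 𝕜 (wpart (plaq (l₁ - l₂) (l₂ - l₃) (l₄ - l₃) (l₁ - l₄) B₁ B₂ B₃ B₄))) = 0 := by
  simp only [two_smul_trace_quad 𝕜 τ, wpart_plaq, sum_four_signed, commSum_four]
  simp only [← map_sub]
  refine trace_eq_zero_of_eq_csum 𝕜 τ hτ
    [(h₃, l₁), (h₃, l₁), (l₄, h₃), (l₄, h₄), (h₂, l₃), (l₁, h₂), (l₁, h₂), (l₃, h₃), (h₁, l₂), (l₁, h₁), (h₄, l₁),
      (h₂, l₂)] ?_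
  simp only [csum_cons, csum_nil]
  noncomm_ring

set_option maxHeartbeats 400000 in
/-- **ORDER `B¹` — THE WARD IDENTITY OF THE WILSON PLAQUETTE JETS (hypothesis (I1) of `Beta.LagrangianGaugeDegeneracy` for these
jets, entry by entry):**
`2·Pol F_{2,1}(h, W₀λ) + 2·Pol F_{2,0}(h, W₁(B)λ) = F_{1,1}(N₀(h)λ)`, i.e. with the letters of this file
`2[τP21(h + W₀λ; B) − τP21(h; B) − τP21(W₀λ; B)] + 2[τquad(h + W₁(B)λ) − τquad(h) − τquad(W₁(B)λ)] = τP11(N₀(h)λ; B)`,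
`W₀λ = (λ₁−λ₂, λ₂−λ₃, λ₄−λ₃, λ₁−λ₄)`, `W₁(B)λ = (λ₂B₁−B₁λ₂, λ₃B₂−B₂λ₃, λ₃B₃−B₃λ₃, λ₄B₄−B₄λ₄)`,
`N₀(h)λ = (h₁(λ₁+λ₂)−(λ₁+λ₂)h₁, …, h₄(λ₁+λ₄)−(λ₁+λ₄)h₄)`.  The right-hand side (the CURRENT paired with `[h, λ₋+λ₊]`) is NOT zero in
general: the Hessian of the jets is degenerate along the gauge directions only up to the gradient term, exactly as (I1) says.
Every ring, every tracial `τ`, all letters; certificate: 136 commutators. [folklore] -/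
theorem ward21 (hτ : ∀ a b : 𝔸, τ (a * b) = τ (b * a)) :
    (2 : 𝕜) • τ (P21 𝕜 (plaq (h₁ + (l₁ - l₂)) (h₂ + (l₂ - l₃)) (h₃ + (l₄ - l₃)) (h₄ + (l₁ - l₄)) B₁ B₂ B₃ B₄))
      - (2 : 𝕜) • τ (P21 𝕜 (plaq h₁ h₂ h₃ h₄ B₁ B₂ B₃ B₄))
      - (2 : 𝕜) • τ (P21 𝕜 (plaq (l₁ - l₂) (l₂ - l₃) (l₄ - l₃) (l₁ - l₄) B₁ B₂ B₃ B₄))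
      + ((2 : 𝕜) • τ (quad 𝕜 (wpart (plaq (h₁ + (l₂ * B₁ - B₁ * l₂)) (h₂ + (l₃ * B₂ - B₂ * l₃))
            (h₃ + (l₃ * B₃ - B₃ * l₃)) (h₄ + (l₄ * B₄ - B₄ * l₄)) B₁ B₂ B₃ B₄)))
          - (2 : 𝕜) • τ (quad 𝕜 (wpart (plaq h₁ h₂ h₃ h₄ B₁ B₂ B₃ B₄)))
          - (2 : 𝕜) • τ (quad 𝕜 (wpart (plaq (l₂ * B₁ - B₁ * l₂) (l₃ * B₂ - B₂ * l₃) (l₃ * B₃ - B₃ * l₃) (l₄ * B₄ - B₄ * l₄)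
            B₁ B₂ B₃ B₄)))) =
      τ (P11 (plaq (h₁ * (l₁ + l₂) - (l₁ + l₂) * h₁) (h₂ * (l₂ + l₃) - (l₂ + l₃) * h₂) (h₃ * (l₄ + l₃) - (l₄ + l₃) * h₃)
        (h₄ * (l₁ + l₄) - (l₁ + l₄) * h₄) B₁ B₂ B₃ B₄)) := by
  have z1 : h₁ + (l₁ - l₂) + (h₂ + (l₂ - l₃)) - (h₃ + (l₄ - l₃)) - (h₄ + (l₁ - l₄)) = h₁ + h₂ - h₃ - h₄ := by abel
  have z2 : l₁ - l₂ + (l₂ - l₃) - (l₄ - l₃) - (l₁ - l₄) = 0 := by abel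
  simp only [two_smul_trace_P21 𝕜 τ hτ, two_smul_trace_quad 𝕜 τ, P11_eq, wpart_plaq, bpart_plaq, twist_plaq, sum_four_signed,
    commSum_four]
  simp only [z1, z2, zero_mul, map_zero, smul_zero, zero_add, add_zero]
  simp only [two_smul]
  simp only [← map_add, ← map_sub]
  refine trace_eq_of_sub_eq_csum 𝕜 τ hτ
    [(B₁, (h₃ * l₁)), (B₁, (h₃ * l₁)), (h₃, (B₁ * l₁)), (h₃, (B₁ * l₁)), ((h₂ * l₁), B₁), ((h₂ * l₁), B₁),
      ((B₁ * l₁), h₂), ((B₁ * l₁), h₂), (B₁, (h₁ * l₂)), (B₁, (h₁ * l₂)), (l₂, (B₁ * h₁)), ((h₁ * l₁), B₁),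
      (h₄, (B₁ * l₁)), (h₄, (B₁ * l₁)), (h₂, (B₁ * l₂)), (h₂, (B₁ * l₂)), (h₁, (B₁ * l₂)), ((l₂ * h₁), B₁),
      (B₁, (h₄ * l₁)), (B₁, (h₄ * l₁)), ((B₁ * l₁), h₁), ((B₁ * l₁), h₁), ((l₁ * h₁), B₁), (B₂, (h₃ * l₁)),
      (B₂, (h₃ * l₁)), (h₃, (B₂ * l₁)), (h₃, (B₂ * l₁)), (B₂, (h₂ * l₃)), (B₂, (h₂ * l₃)), (l₃, (B₂ * h₂)),
      ((h₂ * l₁), B₂), ((h₂ * l₁), B₂), ((B₂ * l₃), h₃), ((B₂ * l₃), h₃), (h₂, (B₂ * l₃)), ((l₃ * h₂), B₂),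
      ((B₂ * l₁), h₂), ((B₂ * l₁), h₂), (B₂, (h₁ * l₂)), ((h₁ * l₁), B₂), (h₄, (B₂ * l₁)), (h₄, (B₂ * l₁)),
      ((l₂ * h₂), B₂), (B₂, (h₂ * l₂)), ((l₂ * h₁), B₂), (B₂, (h₄ * l₁)), (B₂, (h₄ * l₁)), ((B₂ * l₁), h₁),
      ((B₂ * l₁), h₁), ((l₁ * h₁), B₂), ((h₃ * l₁), B₃), ((h₃ * l₁), B₃), ((B₃ * l₁), h₃), ((B₃ * l₁), h₃),
      ((h₂ * l₃), B₃), (B₃, (h₂ * l₁)), (B₃, (h₂ * l₁)), (h₃, (B₃ * l₃)), (B₃, (l₃ * h₂)), (h₂, (B₃ * l₁)),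
      (h₂, (B₃ * l₁)), ((h₁ * l₂), B₃), (B₃, (h₁ * l₁)), ((B₃ * l₁), h₄), ((B₃ * l₁), h₄), (B₃, (l₂ * h₂)),
      ((h₂ * l₂), B₃), (B₃, (l₂ * h₁)), ((h₄ * l₁), B₃), ((h₄ * l₁), B₃), (h₁, (B₃ * l₁)), (h₁, (B₃ * l₁)),
      (B₃, (l₁ * h₁)), ((h₃ * l₁), B₄), ((h₃ * l₁), B₄), (B₄, (h₃ * l₄)), (h₄, (B₄ * l₄)), ((B₄ * l₁), h₃),
      ((B₄ * l₁), h₃), ((l₄ * h₃), B₄), ((h₂ * l₃), B₄), (B₄, (h₂ * l₁)), (B₄, (h₂ * l₁)), ((l₃ * h₃), B₄),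
      (B₄, (h₃ * l₃)), (B₄, (l₃ * h₂)), (h₂, (B₄ * l₁)), (h₂, (B₄ * l₁)), ((h₁ * l₂), B₄), (B₄, (h₁ * l₁)),
      ((B₄ * l₁), h₄), ((B₄ * l₁), h₄), (B₄, (l₂ * h₂)), ((h₂ * l₂), B₄), (B₄, (l₂ * h₁)), ((h₄ * l₁), B₄),
      ((h₄ * l₁), B₄), (h₁, (B₄ * l₁)), (h₁, (B₄ * l₁)), (B₄, (l₁ * h₁)), (B₁, (h₂ * l₂)), (B₁, (h₂ * l₂)),
      (l₂, (B₁ * h₂)), (l₂, (B₁ * h₂)), ((B₁ * l₂), h₃), ((B₁ * l₂), h₃), ((h₃ * l₂), B₁), ((h₃ * l₂), B₁),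
      ((B₁ * h₃), l₂), ((B₁ * h₃), l₂), ((h₃ * l₃), B₂), ((h₃ * l₃), B₂), ((B₂ * h₃), l₃), ((B₂ * h₃), l₃),
      (B₃, (h₃ * l₃)), (l₃, (B₃ * h₃)), ((B₁ * l₂), h₄), ((B₁ * l₂), h₄), ((h₄ * l₂), B₁), ((h₄ * l₂), B₁),
      ((B₁ * h₄), l₂), ((B₁ * h₄), l₂), ((B₂ * l₃), h₄), ((B₂ * l₃), h₄), (h₄, (B₃ * l₃)), (h₄, (B₃ * l₃)),
      ((h₄ * l₃), B₂), ((h₄ * l₃), B₂), ((B₂ * h₄), l₃), ((B₂ * h₄), l₃), (B₃, (h₄ * l₃)), (B₃, (h₄ * l₃)),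
      (l₃, (B₃ * h₄)), (l₃, (B₃ * h₄)), (B₄, (h₄ * l₄)), (l₄, (B₄ * h₄))] ?_
  simp only [csum_cons, csum_nil]
  noncomm_ring

/-- **CONSTANT BACKGROUND: the naive degeneracy holds per plaquette.**  For `B₁ = B₃ = X`, `B₂ = B₄ = Y` the current term of
`ward21` vanishes (`trace_P11_plaq_const`), so `2·Pol F_{2,1}(h, W₀λ) + 2·Pol F_{2,0}(h, W₁(B)λ) = 0` with NO gradient term — the
per-plaquette kernel form of the observation that the Hessian of the Wilson jets is exactly gauge-degenerate on constant
backgrounds at this order (and, by `ward21`, only up to the current elsewhere). [folklore] -/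
theorem ward21_const (hτ : ∀ a b : 𝔸, τ (a * b) = τ (b * a)) (X Y : 𝔸) :
    (2 : 𝕜) • τ (P21 𝕜 (plaq (h₁ + (l₁ - l₂)) (h₂ + (l₂ - l₃)) (h₃ + (l₄ - l₃)) (h₄ + (l₁ - l₄)) X Y X Y))
      - (2 : 𝕜) • τ (P21 𝕜 (plaq h₁ h₂ h₃ h₄ X Y X Y))
      - (2 : 𝕜) • τ (P21 𝕜 (plaq (l₁ - l₂) (l₂ - l₃) (l₄ - l₃) (l₁ - l₄) X Y X Y))
      + ((2 : 𝕜) • τ (quad 𝕜 (wpart (plaq (h₁ + (l₂ * X - X * l₂)) (h₂ + (l₃ * Y - Y * l₃))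
            (h₃ + (l₃ * X - X * l₃)) (h₄ + (l₄ * Y - Y * l₄)) X Y X Y)))
          - (2 : 𝕜) • τ (quad 𝕜 (wpart (plaq h₁ h₂ h₃ h₄ X Y X Y)))
          - (2 : 𝕜) • τ (quad 𝕜 (wpart (plaq (l₂ * X - X * l₂) (l₃ * Y - Y * l₃) (l₃ * X - X * l₃) (l₄ * Y - Y * l₄)
            X Y X Y)))) = 0 := by
  rw [ward21 𝕜 τ X Y X Y h₁ h₂ h₃ h₄ l₁ l₂ l₃ l₄ hτ, trace_P11_plaq_const 𝕜 τ hτ]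

end SecondOrder

/-! ## §4 The lattice-summed form: the Ward identity for `jet21`, `jet20` and the summed `(1,1)`-jet -/

section Lattice

variable (𝕜 : Type*) [RCLike 𝕜] {𝔸 : Type*} [NormedRing 𝔸] [NormedAlgebra 𝕜 𝔸]
variable {V : Type*} [AddCommGroup V] [Module 𝕜 V]
variable {Λ : Type*} [Fintype Λ] [AddCommGroup Λ] {D : Type*} [Fintype D]

/-- THE ORDER-`B⁰` GAUGE-DIRECTION FIELD of a site field `λ : Λ → 𝔸`: `(W₀λ)_μ(x) = λ(x) − λ(x + e_μ)` (`λ(b₋) − λ(b₊)`; minus the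
forward lattice gradient).  A definition asserting nothing. [folklore] -/
def gaugeDir₀ (e : D → Λ) (lam : Λ → 𝔸) : Λ → D → 𝔸 := fun x μ => lam x - lam (x + e μ)

/-- THE ORDER-`B¹` GAUGE-DIRECTION FIELD: `(W₁(B)λ)_μ(x) = λ(x + e_μ)·B_μ(x) − B_μ(x)·λ(x + e_μ) = −[B_μ(x), λ(x + e_μ)]` (the
`B`-linear part of `λ(b₋) − Ad_{e^{B_b}}λ(b₊)`).  A definition asserting nothing. [folklore] -/
def gaugeDir₁ (e : D → Λ) (B : Λ → D → 𝔸) (lam : Λ → 𝔸) : Λ → D → 𝔸 :=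
  fun x μ => lam (x + e μ) * B x μ - B x μ * lam (x + e μ)

/-- THE ORDER-`B⁰` CURRENT ARGUMENT: `(N₀(h)λ)_μ(x) = h_μ(x)·(λ(x) + λ(x + e_μ)) − (λ(x) + λ(x + e_μ))·h_μ(x) = [h_b, λ(b₋) + λ(b₊)]`.
A definition asserting nothing. [folklore] -/
def currArg₀ (e : D → Λ) (h : Λ → D → 𝔸) (lam : Λ → 𝔸) : Λ → D → 𝔸 :=
  fun x μ => h x μ * (lam x + lam (x + e μ)) - (lam x + lam (x + e μ)) * h x μ

/-- **THE SUMMED `(1,1)`-JET** (one fluctuation letter, one background letter): `Σ_x Σ_{(μ,ν)} τ(P11(word of p_{μν}(x)))` — the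
background-linear part of the CURRENT (the `W`-gradient of `Σ τU(∂p)` at `W = 0`), companion of `PlaquetteVertex.jet21`/`jet20`.
A definition asserting nothing. [folklore] -/
def jet11 (τ : 𝔸 →ₗ[𝕜] V) (e : D → Λ) (W B : Λ → D → 𝔸) : V :=
  ∑ x, ∑ μ, ∑ ν, τ (P11 (plaqWord e W B x μ ν))

omit [Fintype Λ] [Fintype D] in
/-- `ward21` AT THE LATTICE PLAQUETTE `p_{μν}(x)`: the letters of `PlaquetteVertex.plaqWord` for the fields `h + W₀λ`, `h`, `W₀λ`,
`h + W₁(B)λ`, `W₁(B)λ` and `N₀(h)λ` are an instance of the free letters of `ward21` (the far corner `x + e_ν + e_μ = x + e_μ + e_ν` closes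
the plaquette). [folklore] -/
theorem ward21_plaqWord (τ : 𝔸 →ₗ[𝕜] V) (hτ : ∀ a b : 𝔸, τ (a * b) = τ (b * a)) (e : D → Λ) (h B : Λ → D → 𝔸) (lam : Λ → 𝔸)
    (x : Λ) (μ ν : D) :
    (2 : 𝕜) • τ (P21 𝕜 (plaqWord e (h + gaugeDir₀ e lam) B x μ ν)) - (2 : 𝕜) • τ (P21 𝕜 (plaqWord e h B x μ ν))
      - (2 : 𝕜) • τ (P21 𝕜 (plaqWord e (gaugeDir₀ e lam) B x μ ν))
      + ((2 : 𝕜) • τ (quad 𝕜 (wpart (plaqWord e (h + gaugeDir₁ e B lam) B x μ ν)))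
          - (2 : 𝕜) • τ (quad 𝕜 (wpart (plaqWord e h B x μ ν)))
          - (2 : 𝕜) • τ (quad 𝕜 (wpart (plaqWord e (gaugeDir₁ e B lam) B x μ ν)))) =
      τ (P11 (plaqWord e (currArg₀ e h lam) B x μ ν)) := by
  simp only [plaqWord, Pi.add_apply, gaugeDir₀, gaugeDir₁, currArg₀]
  rw [add_right_comm x (e ν) (e μ)]
  exact ward21 𝕜 τ (B x μ) (B (x + e μ) ν) (B (x + e ν) μ) (B x ν) (h x μ) (h (x + e μ) ν) (h (x + e ν) μ) (h x ν)
    (lam x) (lam (x + e μ)) (lam (x + e μ + e ν)) (lam (x + e ν)) hτ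

/-- **THE WARD IDENTITY FOR THE SUMMED WILSON JETS (hypothesis (I1) of `Beta.LagrangianGaugeDegeneracy` at order `B¹`, typed on
`PlaquetteVertex.jet21` / `jet20` / `jet11`):**
`2·[jet21(h + W₀λ) − jet21(h) − jet21(W₀λ)] + 2·[jet20(h + W₁(B)λ) − jet20(h) − jet20(W₁(B)λ)] = jet11(N₀(h)λ)`
for every background `B`, every `h`, every site field `λ`, every ring and every tracial `τ` — the sum over all sites and ordered
direction pairs of `ward21_plaqWord`.  The polarised Hessian of the `(W², B^{≤1})` jets along the gauge directions equals the
`(1,1)`-current on `[h, λ₋ + λ₊]`; it is NOT zero off constant backgrounds. [folklore] -/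
theorem jet21_ward (τ : 𝔸 →ₗ[𝕜] V) (hτ : ∀ a b : 𝔸, τ (a * b) = τ (b * a)) (e : D → Λ) (h B : Λ → D → 𝔸) (lam : Λ → 𝔸) :
    (2 : 𝕜) • (jet21 𝕜 τ e (h + gaugeDir₀ e lam) B - jet21 𝕜 τ e h B - jet21 𝕜 τ e (gaugeDir₀ e lam) B)
      + (2 : 𝕜) • (jet20 𝕜 τ e (h + gaugeDir₁ e B lam) B - jet20 𝕜 τ e h B - jet20 𝕜 τ e (gaugeDir₁ e B lam) B) =
      jet11 𝕜 τ e (currArg₀ e h lam) B := by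
  simp only [jet21, jet20, jet11, smul_sub, Finset.smul_sum, ← Finset.sum_sub_distrib, ← Finset.sum_add_distrib]
  refine Finset.sum_congr rfl fun x _ => Finset.sum_congr rfl fun μ _ => Finset.sum_congr rfl fun ν _ => ?_
  exact ward21_plaqWord 𝕜 τ hτ e h B lam x μ ν

/-- **FIRST ORDER, SUMMED: the `(1,1)`-current annihilates the order-`B⁰` gauge directions**: `jet11(W₀λ) = 0` for every
background — the sum of `ward11`. [folklore] -/
theorem jet11_gaugeDir₀ (τ : 𝔸 →ₗ[𝕜] V) (hτ : ∀ a b : 𝔸, τ (a * b) = τ (b * a)) (e : D → Λ) (B : Λ → D → 𝔸) (lam : Λ → 𝔸) :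
    jet11 𝕜 τ e (gaugeDir₀ e lam) B = 0 := by
  refine Finset.sum_eq_zero fun x _ => Finset.sum_eq_zero fun μ _ => Finset.sum_eq_zero fun ν _ => ?_
  simp only [plaqWord, gaugeDir₀]
  rw [add_right_comm x (e ν) (e μ)]
  exact ward11 𝕜 τ (B x μ) (B (x + e μ) ν) (B (x + e ν) μ) (B x ν) (lam x) (lam (x + e μ)) (lam (x + e μ + e ν)) (lam (x + e ν)) hτ

end Lattice

end Literature.MathematicalPhysics.QuantumFieldTheory.Balaban1983to89.Beta.WilsonWardJets
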